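import Summits.KontsevichZagierPeriods.KontsevichZagierPeriods.Theorems.SoloBlindLandenModulus
import Literature.NumberTheory.Transcendental.KZDominatedFamilyRelations
import Literature.NumberTheory.Transcendental.KZRegCalculus
import HarnessLib

/-!
# Landen's transformation inside the rules, II: the second kind

For real algebraic `k ∈ (0,1)`, `λ = 4k/(1+k)²`, the pullback of the `E_λ`-integrand under Gauss'
map `x = (1+k)t/(1+kt²)` differs from `(2 e_{k²} - (1-k²) f_{k²})/(1+k)` by the EXACT derivative of
`Φ(t) = 2k t √((1-t²)(1-k²t²))/(1+kt²)`, `Φ(0) = Φ(1) = 0`.  Hence, by one rule-(2) move, one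
Newton–Leibniz move, additivity and a null modification,
`(1+k)[E_λ] + (1-k²)[K_{k²}] = 2[E_{k²}]` in `Q` (`mkQ_landen_second`,
`landen_second_mem_relations`)
and on values `(1+k) E(2√k/(1+k)) + (1-k²) K(k) = 2 E(k)` (`landen_second`).
-/

noncomputable section

namespace Summit.KontsevichZagierPeriods.KontsevichZagierPeriods.Theorems

open Set MeasureTheory
open Literature.ModelTheory.ExponentialFields (IsSemialgebraic)
open Literature.NumberTheory.Transcendental
open Literature.NumberTheory.Transcendental.KZ

namespace SoloBlind

section SecondKind

/-! ## The weight, the pullback and the primitive -/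

/-- The weight `W_k(t) = (1+k)²(1-kt²)²/(1+kt²)² + (1-k²) - 2(1-k²t²)`. -/
def landenW (k t : ℝ) : ℝ :=
  (1 + k) ^ 2 * (1 - k * t ^ 2) ^ 2 / (1 + k * t ^ 2) ^ 2 + (1 - k ^ 2) - 2 * (1 - k ^ 2 * t ^ 2)

/-- The pulled-back `E`-integrand `(1+k)(1-kt²)²/(1+kt²)² · f_{k²}(t)`. -/
def landenEPull (k t : ℝ) : ℝ :=
  (1 + k) * (1 - k * t ^ 2) ^ 2 / (1 + k * t ^ 2) ^ 2 * ellKf (k ^ 2) t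

/-- The primitive `Φ_k(t) = 2k t √((1-t²)(1-k²t²)) / (1+kt²)`. -/
def landenPhi (k t : ℝ) : ℝ :=
  2 * k * t * Real.sqrt ((1 - t ^ 2) * (1 - k ^ 2 * t ^ 2)) / (1 + k * t ^ 2)

variable {k t : ℝ}

/-- `Φ_k(0) = 0`. -/
theorem landenPhi_zero (k : ℝ) : landenPhi k 0 = 0 := by simp [landenPhi]

/-- `Φ_k(1) = 0`. -/
theorem landenPhi_one (k : ℝ) : landenPhi k 1 = 0 := by simp [landenPhi]

/-- `|W_k| ≤ 7` on `(0,1)` for `k ∈ (0,1)`. -/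
theorem abs_landenW_le (hk : k ∈ Ioo (0:ℝ) 1) (ht : t ∈ Ioo (0:ℝ) 1) : |landenW k t| ≤ 7 := by
  obtain ⟨hD, hE, hP, hQ⟩ := landen_aux hk ht
  have h1 : 0 ≤ (1 + k) ^ 2 * (1 - k * t ^ 2) ^ 2 / (1 + k * t ^ 2) ^ 2 := by positivity
  have h2 : (1 + k) ^ 2 * (1 - k * t ^ 2) ^ 2 / (1 + k * t ^ 2) ^ 2 ≤ 4 := by
    rw [div_le_iff₀ (by positivity)]
    have h3 : (1 - k * t ^ 2) ^ 2 ≤ (1 + k * t ^ 2) ^ 2 := by nlinarith [hk.1, sq_nonneg t]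
    have h4 : (1 + k) ^ 2 ≤ 4 := by nlinarith [hk.1, hk.2]
    exact mul_le_mul h4 h3 (sq_nonneg _) (by norm_num)
  rw [landenW, abs_le]
  constructor <;> nlinarith [hk.1, hk.2, sq_nonneg t, sq_nonneg k]

/-- The quotient rule for `A/√u` at a point where `u > 0`, in the form
`(A/√u)' = (A'u - A u'/2)/(u√u)`. -/
theorem hasDerivAt_ratio_sqrt {A u : ℝ → ℝ} {A' u' x : ℝ} (hA : HasDerivAt A A' x)
    (hu : HasDerivAt u u' x) (hpos : 0 < u x) :
    HasDerivAt (fun s => A s / Real.sqrt (u s))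
      ((A' * u x - A x * u' / 2) / (u x * Real.sqrt (u x))) x := by
  have ht : 0 < Real.sqrt (u x) := Real.sqrt_pos.mpr hpos
  have hsq : Real.sqrt (u x) ^ 2 = u x := Real.sq_sqrt hpos.le
  refine (hA.div (hu.sqrt hpos.ne') ht.ne').congr_deriv ?_
  generalize Real.sqrt (u x) = t at ht hsq ⊢
  rw [← hsq]
  field_simp

/-- **Exactness**: `Φ_k' = f_{k²} · W_k` on `(0,1)`. -/
theorem hasDerivAt_landenPhi (hk : k ∈ Ioo (0:ℝ) 1) (ht : t ∈ Ioo (0:ℝ) 1) :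
    HasDerivAt (landenPhi k) (ellKf (k ^ 2) t * landenW k t) t := by
  obtain ⟨hD, hE, hP, hQ⟩ := landen_aux hk ht
  have hsq : ∀ s : ℝ, HasDerivAt (fun s : ℝ => s ^ 2) (2 * s) s := fun s => by
    simpa using hasDerivAt_pow 2 s
  have hu : HasDerivAt (fun s : ℝ => (1 - s ^ 2) * (1 - k ^ 2 * s ^ 2))
      (-(2 * t) * (1 - k ^ 2 * t ^ 2) + (1 - t ^ 2) * (-(k ^ 2 * (2 * t)))) t :=
    ((hsq t).const_sub 1).mul (((hsq t).const_mul (k ^ 2)).const_sub 1)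
  have hA : HasDerivAt (fun s : ℝ => 2 * k * s * ((1 - s ^ 2) * (1 - k ^ 2 * s ^ 2)) /
      (1 + k * s ^ 2)) _ t :=
    ((((hasDerivAt_id' t).const_mul (2 * k)).mul hu).div (((hsq t).const_mul k).const_add 1)
      hD.ne')
  have h := hasDerivAt_ratio_sqrt hA hu (mul_pos hP hQ)
  have heq : (fun s => 2 * k * s * ((1 - s ^ 2) * (1 - k ^ 2 * s ^ 2)) / (1 + k * s ^ 2) /
      Real.sqrt ((1 - s ^ 2) * (1 - k ^ 2 * s ^ 2))) =ᶠ[nhds t] landenPhi k := by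
    refine Filter.eventually_of_mem (Ioo_mem_nhds ht.1 ht.2) fun s hs => ?_
    obtain ⟨hDs, -, hPs, hQs⟩ := landen_aux hk hs
    have hr : 0 < Real.sqrt ((1 - s ^ 2) * (1 - k ^ 2 * s ^ 2)) :=
      Real.sqrt_pos.mpr (mul_pos hPs hQs)
    rw [landenPhi, div_eq_iff hr.ne', div_mul_eq_mul_div, mul_assoc (2 * k * s),
      Real.mul_self_sqrt (mul_pos hPs hQs).le]
  refine (h.congr_of_eventuallyEq heq.symm).congr_deriv ?_
  have hr : 0 < Real.sqrt ((1 - t ^ 2) * (1 - k ^ 2 * t ^ 2)) :=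
    Real.sqrt_pos.mpr (mul_pos hP hQ)
  simp only [Pi.mul_apply, ellKf, landenW]
  field_simp
  ring

/-- `Φ_k` is continuous. -/
theorem continuous_landenPhi (hk : k ∈ Ioo (0:ℝ) 1) : Continuous (landenPhi k) := by
  unfold landenPhi
  exact Continuous.div (by fun_prop) (by fun_prop) fun s => by nlinarith [hk.1, sq_nonneg s]

/-- `Φ_k` is `ℚ`-semialgebraic on the line `[0,1]` (`k` algebraic). -/
theorem isSemialgebraicFunOn_landenPhi (hka : IsAlgebraic ℚ k) :
    IsSemialgebraicFunOn ℚ (line (Icc (0:ℝ) 1)) fun x => landenPhi k (x 0) := by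
  have hW : IsSemialgebraic ℚ (line (Icc (0:ℝ) 1)) :=
    isSemialgebraic_line_Icc isAlgebraic_zero isAlgebraic_one
  have ha := isSemialgebraicFunOn_apply hW 0
  have h1 := isSemialgebraicFunOn_const_of_isAlgebraic hW isAlgebraic_one
  have hc := isSemialgebraicFunOn_const_of_isAlgebraic hW hka
  have h2 := isSemialgebraicFunOn_const_ofNat hW 2
  exact ((((h2.fun_mul hc).fun_mul ha).fun_mul ((h1.fun_sub (ha.fun_pow 2)).fun_mul
    (h1.fun_sub ((hc.fun_pow 2).fun_mul (ha.fun_pow 2)))).fun_sqrt).fun_mul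
    ((h1.fun_add (hc.fun_mul (ha.fun_pow 2))).fun_inv)).congr
    fun x _ => by simp only [landenPhi, div_eq_mul_inv]

/-- **The `E`-pullback identity** `(1+k) e_λ(φ(t)) |φ'(t)| = (1+k) · landenEPull k t`. -/
theorem landen_pullback_second (hk : k ∈ Ioo (0:ℝ) 1) (ht : t ∈ Ioo (0:ℝ) 1) :
    (1 + k) * landenEPull k t =
      (1 + k) * ellEf (landenMod k) (gaussMap k t) * |gaussMapDeriv k t| := by
  obtain ⟨hD, hE, hP, hQ⟩ := landen_aux hk ht
  have hl : landenMod k ∈ Icc (0:ℝ) 1 := Ioo_subset_Icc_self (landenMod_mem hk)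
  have key : 1 - landenMod k * gaussMap k t ^ 2 = (1 - k * t ^ 2) ^ 2 / (1 + k * t ^ 2) ^ 2 := by
    have h1 : 1 + k ≠ 0 := by linarith [hk.1]
    rw [gaussMap, landenMod]
    field_simp
    ring
  rw [ellEf_eq (gaussMap_mem hk ht) hl, key, landenEPull, mul_assoc (1 + k) (_ * _),
    mul_assoc ((1 - k * t ^ 2) ^ 2 / (1 + k * t ^ 2) ^ 2), ← landen_pullback hk ht]
  ring

/-- `landenEPull k ∘ a` is `ℚ`-semialgebraic for a semialgebraic coordinate `a`. -/
theorem isSemialgebraicFunOn_landenEPull {n : ℕ} {W : Set (Fin n → ℝ)} {a : (Fin n → ℝ) → ℝ}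
    (ha : IsSemialgebraicFunOn ℚ W a) (hka : IsAlgebraic ℚ k) :
    IsSemialgebraicFunOn ℚ W fun x => landenEPull k (a x) := by
  have hW := ha.isSemialgebraic_holds
  have h1 := isSemialgebraicFunOn_const_of_isAlgebraic hW isAlgebraic_one
  have hc := isSemialgebraicFunOn_const_of_isAlgebraic hW hka
  exact ((((h1.fun_add hc).fun_mul ((h1.fun_sub (hc.fun_mul (ha.fun_pow 2))).fun_pow 2)).fun_mul
    ((h1.fun_add (hc.fun_mul (ha.fun_pow 2))).fun_pow 2).fun_inv).fun_mul
    (isSemialgebraicFunOn_ellKf ha (hka.pow 2))).congr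
    fun x _ => by simp only [landenEPull, div_eq_mul_inv]

/-- `landenW k ∘ a` is `ℚ`-semialgebraic for a semialgebraic coordinate `a`. -/
theorem isSemialgebraicFunOn_landenW {n : ℕ} {W : Set (Fin n → ℝ)} {a : (Fin n → ℝ) → ℝ}
    (ha : IsSemialgebraicFunOn ℚ W a) (hka : IsAlgebraic ℚ k) :
    IsSemialgebraicFunOn ℚ W fun x => landenW k (a x) := by
  have hW := ha.isSemialgebraic_holds
  have h1 := isSemialgebraicFunOn_const_of_isAlgebraic hW isAlgebraic_one
  have hc := isSemialgebraicFunOn_const_of_isAlgebraic hW hka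
  have h2 := isSemialgebraicFunOn_const_ofNat hW 2
  exact ((((((h1.fun_add hc).fun_pow 2).fun_mul ((h1.fun_sub (hc.fun_mul (ha.fun_pow 2))).fun_pow
    2)).fun_mul ((h1.fun_add (hc.fun_mul (ha.fun_pow 2))).fun_pow 2).fun_inv).fun_add
    (h1.fun_sub (hc.fun_pow 2))).fun_sub (h2.fun_mul (h1.fun_sub ((hc.fun_pow 2).fun_mul
    (ha.fun_pow 2))))).congr
    fun x _ => by simp only [landenW, div_eq_mul_inv]

/-- `(1+k) · landenEPull k` is integrable on `(0,1)`. -/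
theorem integrableOn_landenEPull (hk : k ∈ Ioo (0:ℝ) 1) :
    IntegrableOn (fun t => (1 + k) * landenEPull k t) (Ioo 0 1) := by
  have hk2 : k ^ 2 ∈ Ico (0:ℝ) 1 := Ioo_subset_Ico_self (sq_mem_Ioo k hk)
  refine integrableOn_Ioo_of_le (by unfold landenEPull ellKf; fun_prop)
    ((1 + k) * ((1 + k) * (1 / Real.sqrt (1 - k ^ 2)))) fun t ht => ?_
  obtain ⟨hD, hE, -, -⟩ := landen_aux hk ht
  have hf := abs_ellKf_le ht hk2
  have hq : (1 - k * t ^ 2) ^ 2 / (1 + k * t ^ 2) ^ 2 ≤ 1 := by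
    rw [div_le_one (by positivity)]; nlinarith [hk.1, sq_nonneg t]
  have h1k : (0:ℝ) < 1 + k := by linarith [hk.1]
  rw [landenEPull, abs_mul, abs_mul, abs_of_pos h1k, mul_div_assoc,
    abs_of_nonneg (by positivity : (0:ℝ) ≤ (1 + k) * ((1 - k * t ^ 2) ^ 2 / (1 + k * t ^ 2) ^ 2))]
  calc (1 + k) * ((1 + k) * ((1 - k * t ^ 2) ^ 2 / (1 + k * t ^ 2) ^ 2) * |ellKf (k ^ 2) t|)
      ≤ (1 + k) * ((1 + k) * 1 * (1 / Real.sqrt (1 - k ^ 2) * (1 / Real.sqrt (1 - t)))) := by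
        gcongr
    _ = _ := by ring

/-- `f_{k²} · W_k` is integrable on `[0,1]`. -/
theorem integrableOn_landenExact (hk : k ∈ Ioo (0:ℝ) 1) :
    IntegrableOn (fun t => ellKf (k ^ 2) t * landenW k t) (Icc 0 1) := by
  have hk2 : k ^ 2 ∈ Ico (0:ℝ) 1 := Ioo_subset_Ico_self (sq_mem_Ioo k hk)
  refine (integrableOn_Ioo_of_le (by unfold ellKf landenW; fun_prop)
    (7 * (1 / Real.sqrt (1 - k ^ 2))) fun t ht => ?_).congr_set_ae Ioo_ae_eq_Icc.symm
  rw [abs_mul, mul_comm]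
  calc |landenW k t| * |ellKf (k ^ 2) t|
      ≤ 7 * (1 / Real.sqrt (1 - k ^ 2) * (1 / Real.sqrt (1 - t))) :=
        mul_le_mul (abs_landenW_le hk ht) (abs_ellKf_le ht hk2) (abs_nonneg _) (by norm_num)
    _ = 7 * (1 / Real.sqrt (1 - k ^ 2)) * (1 / Real.sqrt (1 - t)) := by ring

section

variable (k : ℝ) (hka : IsAlgebraic ℚ k) (hk : k ∈ Ioo (0:ℝ) 1)

/-! ## The representations -/

/-- The scaled `E`-pullback `[(0,1), (1+k) · landenEPull]`. -/
def landenESrc : IntegralRep 1 :=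
  lineRep (Ioo 0 1) (fun t => (1 + k) * landenEPull k t)
    (isSemialgebraic_line_Ioo isAlgebraic_zero isAlgebraic_one)
    ((isSemialgebraicFunOn_const_of_isAlgebraic
        (isSemialgebraic_line_Ioo isAlgebraic_zero isAlgebraic_one)
        (isAlgebraic_one.add hka)).fun_mul
      (isSemialgebraicFunOn_landenEPull (isSemialgebraicFunOn_apply
        (isSemialgebraic_line_Ioo isAlgebraic_zero isAlgebraic_one) 0) hka))
    (integrableOn_landenEPull hk)

/-- The scaled target `[(0,1), (1+k) e_λ]`. -/
def landenETgt : IntegralRep 1 :=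
  lineRep (Ioo 0 1) (fun t => (1 + k) * ellEf (landenMod k) t)
    (isSemialgebraic_line_Ioo isAlgebraic_zero isAlgebraic_one)
    ((isSemialgebraicFunOn_const_of_isAlgebraic
        (isSemialgebraic_line_Ioo isAlgebraic_zero isAlgebraic_one)
        (isAlgebraic_one.add hka)).fun_mul
      (isSemialgebraicFunOn_ellEf (isSemialgebraicFunOn_apply
        (isSemialgebraic_line_Ioo isAlgebraic_zero isAlgebraic_one) 0) (isAlgebraic_landenMod hka)))
    ((integrableOn_ellEf (Ioo_subset_Ico_self (landenMod_mem hk))).const_mul (1 + k))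

/-- The exact form on the closed interval `[[0,1], f_{k²} W_k]`. -/
def landenExact : IntegralRep 1 :=
  lineRep (Icc 0 1) (fun t => ellKf (k ^ 2) t * landenW k t)
    (isSemialgebraic_line_Icc isAlgebraic_zero isAlgebraic_one)
    ((isSemialgebraicFunOn_ellKf (isSemialgebraicFunOn_apply
        (isSemialgebraic_line_Icc isAlgebraic_zero isAlgebraic_one) 0) (hka.pow 2)).fun_mul
      (isSemialgebraicFunOn_landenW (isSemialgebraicFunOn_apply
        (isSemialgebraic_line_Icc isAlgebraic_zero isAlgebraic_one) 0) hka))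
    (integrableOn_landenExact hk)

/-- The exact form on the open interval (a restriction of `landenExact`). -/
def landenExactO : IntegralRep 1 :=
  (landenExact k hka hk).restrict (line (Ioo 0 1))
    (isSemialgebraic_line_Ioo isAlgebraic_zero isAlgebraic_one) fun _ hx => Ioo_subset_Icc_self hx

/-- The combination `[(0,1), (1+k) landenEPull + (1-k²) f_{k²}]`. -/
def landenComb : IntegralRep 1 :=
  lineRep (Ioo 0 1) (fun t => (1 + k) * landenEPull k t + (1 - k ^ 2) * ellKf (k ^ 2) t)
    (isSemialgebraic_line_Ioo isAlgebraic_zero isAlgebraic_one)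
    (((isSemialgebraicFunOn_const_of_isAlgebraic
        (isSemialgebraic_line_Ioo isAlgebraic_zero isAlgebraic_one)
        (isAlgebraic_one.add hka)).fun_mul
      (isSemialgebraicFunOn_landenEPull (isSemialgebraicFunOn_apply
        (isSemialgebraic_line_Ioo isAlgebraic_zero isAlgebraic_one) 0) hka)).fun_add
      ((isSemialgebraicFunOn_const_of_isAlgebraic
        (isSemialgebraic_line_Ioo isAlgebraic_zero isAlgebraic_one)
        (isAlgebraic_one.sub (hka.pow 2))).fun_mul
      (isSemialgebraicFunOn_ellKf (isSemialgebraicFunOn_apply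
        (isSemialgebraic_line_Ioo isAlgebraic_zero isAlgebraic_one) 0) (hka.pow 2))))
    ((integrableOn_landenEPull hk).add
      ((integrableOn_ellKf (Ioo_subset_Ico_self (sq_mem_Ioo k hk))).const_mul (1 - k ^ 2)))

/-- The doubled `E`-cell `[(0,1), 2 e_{k²}]`. -/
def landenTwoE : IntegralRep 1 :=
  (ellE (k ^ 2) (hka.pow 2) (sq_mem_Ioo k hk)).constMul 2 (isAlgebraic_nat 2)

/-! ## The moves -/

/-- Move 1 (rule (2), Gauss's substitution): `[landenESrc] - [landenETgt] ∈ relations`. -/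
theorem landenESrc_sub_landenETgt :
    of (landenESrc k hka hk) - of (landenETgt k hka hk) ∈ relations := by
  unfold landenESrc landenETgt
  exact lineRep_subst (gaussMap k) (gaussMapDeriv k) (isSemialgebraicFunOn_gaussMap hka)
    (fun t ht => (hasDerivAt_gaussMap hk ht).hasDerivWithinAt) (injOn_gaussMap hk)
    (image_gaussMap hk) (fun t ht => landen_pullback_second hk ht)

/-- Move 2 (scaling): `(1+k)·E_λ - [landenETgt] ∈ relations`. -/
theorem constMul_sub_landenETgt :
    of ((ellE (landenMod k) (isAlgebraic_landenMod hka) (landenMod_mem hk)).constMul (1 + k)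
        (isAlgebraic_one.add hka)) - of (landenETgt k hka hk) ∈ relations :=
  of_sub_of_mem_relations_of_eqOn rfl fun x _ => by
    simp [IntegralRep.integrand_constMul, landenETgt, ellE_integrand]

/-- Move 3 (rule (1)): `[landenComb] - [landenESrc] - (1-k²)·K_{k²} ∈ relations`. -/
theorem landenComb_sub_sub :
    of (landenComb k hka hk) - of (landenESrc k hka hk) -
      of ((ellK (k ^ 2) (hka.pow 2) (sq_mem_Ioo k hk)).constMul (1 - k ^ 2)
        (isAlgebraic_one.sub (hka.pow 2))) ∈ relations := by
  refine integrandAddRel_subset_relations ⟨1, landenComb k hka hk, landenESrc k hka hk,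
    (ellK (k ^ 2) (hka.pow 2) (sq_mem_Ioo k hk)).constMul (1 - k ^ 2)
      (isAlgebraic_one.sub (hka.pow 2)), rfl, rfl, fun w _ => ?_, rfl⟩
  simp [landenComb, landenESrc, IntegralRep.integrand_constMul, ellK_integrand]

/-- Move 4 (rule (1)): `[landenComb] - [2 e_{k²}] - [Φ' on (0,1)] ∈ relations` — the pointwise
identity `(1+k)·landenEPull + (1-k²) f = 2 e + f W`. -/
theorem landenComb_sub_twoE_sub :
    of (landenComb k hka hk) - of (landenTwoE k hka hk) - of (landenExactO k hka hk) ∈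
      relations := by
  refine integrandAddRel_subset_relations ⟨1, landenComb k hka hk, landenTwoE k hka hk,
    landenExactO k hka hk, rfl, rfl, fun w hw => ?_, rfl⟩
  have hw0 : w 0 ∈ Ioo (0:ℝ) 1 := by simpa [landenComb, line] using hw
  have hk2 : k ^ 2 ∈ Icc (0:ℝ) 1 := Ioo_subset_Icc_self (sq_mem_Ioo k hk)
  simp only [landenComb, landenTwoE, landenExactO, landenExact, lineRep_integrand,
    IntegralRep.integrand_constMul, IntegralRep.integrand_restrict, Pi.add_apply,
    ellE_integrand, ellEf_eq hw0 hk2, landenEPull, landenW]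
  ring

/-- Move 5 (null modification): `[Φ' on [0,1]] - [Φ' on (0,1)] ∈ relations`. -/
theorem landenExact_sub_landenExactO :
    of (landenExact k hka hk) - of (landenExactO k hka hk) ∈ relations := by
  refine IntegralRep.of_sub_of_restrict_mem_relations _ _ _ ?_
  show volume (line (Icc (0 : ℝ) 1 \ Ioo 0 1)) = 0
  rw [volume_line, Icc_sdiff_Ioo_same zero_le_one]
  exact (toFinite _).measure_zero _

/-- Move 6 (rule (3), Newton–Leibniz on `[0,1]`): `[Φ' on [0,1]] ∈ relations`, since
`Φ(1) - Φ(0) = 0`. -/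
theorem landenExact_mem_relations : of (landenExact k hka hk) ∈ relations := by
  have h : of (landenExact k hka hk) -
      of (constCell (landenPhi k 1 - landenPhi k 0) (by
        rw [landenPhi_one, landenPhi_zero, sub_zero]; exact isAlgebraic_zero)) ∈ relations :=
    lineRep_newtonLeibniz isAlgebraic_zero isAlgebraic_one zero_le_one (landenPhi k)
      (isSemialgebraicFunOn_landenPhi hka) (continuous_landenPhi hk).continuousOn
      fun t ht => hasDerivAt_landenPhi hk ht
  have h0 : of (constCell (landenPhi k 1 - landenPhi k 0) (by
      rw [landenPhi_one, landenPhi_zero, sub_zero]; exact isAlgebraic_zero)) ∈ relations := by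
    rw [constCell_congr (by rw [landenPhi_one, landenPhi_zero, sub_zero]) (hβ := isAlgebraic_zero)]
    exact constCell_zero
  simpa using relations.add_mem h h0

/-- Hence `[Φ' on (0,1)] ∈ relations`. -/
theorem landenExactO_mem_relations : of (landenExactO k hka hk) ∈ relations := by
  have h := relations.sub_mem (landenExact_mem_relations k hka hk)
    (landenExact_sub_landenExactO k hka hk)
  rwa [sub_sub_cancel] at h

/-! ## Landen's transformation of the second kind -/

/-- **`(1+k)·[E_λ] + (1-k²)·[K_{k²}] = 2·[E_{k²}]` in `Q`**, `λ = 4k/(1+k)²`. -/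
theorem mkQ_landen_second :
    (⟨1 + k, mem_K₀_iff.mpr (isAlgebraic_one.add hka)⟩ : K₀) •
        mkQ (of (ellE (landenMod k) (isAlgebraic_landenMod hka) (landenMod_mem hk))) +
      (⟨1 - k ^ 2, mem_K₀_iff.mpr (isAlgebraic_one.sub (hka.pow 2))⟩ : K₀) •
        mkQ (of (ellK (k ^ 2) (hka.pow 2) (sq_mem_Ioo k hk))) =
      (⟨2, mem_K₀_iff.mpr (isAlgebraic_nat 2)⟩ : K₀) •
        mkQ (of (ellE (k ^ 2) (hka.pow 2) (sq_mem_Ioo k hk))) := by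
  rw [← mkQ_constMul _ (1 + k) (isAlgebraic_one.add hka),
    ← mkQ_constMul _ (1 - k ^ 2) (isAlgebraic_one.sub (hka.pow 2)),
    ← mkQ_constMul _ 2 (isAlgebraic_nat 2)]
  have h1 : mkQ (of ((ellE (landenMod k) (isAlgebraic_landenMod hka) (landenMod_mem hk)).constMul
      (1 + k) (isAlgebraic_one.add hka))) = mkQ (of (landenESrc k hka hk)) := by
    rw [mkQ_eq_mkQ_iff]
    have h := relations.sub_mem (constMul_sub_landenETgt k hka hk)
      (landenESrc_sub_landenETgt k hka hk)
    rwa [sub_sub_sub_cancel_right] at h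
  have h3 := mkQ_eq_mkQ_iff.mpr
    (show of (landenComb k hka hk) - (of (landenESrc k hka hk) + of ((ellK (k ^ 2) (hka.pow 2)
      (sq_mem_Ioo k hk)).constMul (1 - k ^ 2) (isAlgebraic_one.sub (hka.pow 2)))) ∈ relations by
      rw [← sub_sub]; exact landenComb_sub_sub k hka hk)
  have h4 := mkQ_eq_mkQ_iff.mpr
    (show of (landenComb k hka hk) - (of (landenTwoE k hka hk) + of (landenExactO k hka hk)) ∈
      relations by rw [← sub_sub]; exact landenComb_sub_twoE_sub k hka hk)
  have h6 : mkQ (of (landenExactO k hka hk)) = 0 :=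
    mkQ_eq_zero_iff.mpr (landenExactO_mem_relations k hka hk)
  rw [map_add] at h3 h4
  rw [h1, ← h3, h4, h6, add_zero]
  rfl

/-- **Landen's transformation of the second kind inside the rules**:
`(1+k)·E_λ + (1-k²)·K_{k²} - 2·E_{k²} ∈ relations`. -/
theorem landen_second_mem_relations :
    of ((ellE (landenMod k) (isAlgebraic_landenMod hka) (landenMod_mem hk)).constMul (1 + k)
        (isAlgebraic_one.add hka)) +
      of ((ellK (k ^ 2) (hka.pow 2) (sq_mem_Ioo k hk)).constMul (1 - k ^ 2)
        (isAlgebraic_one.sub (hka.pow 2))) -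
      of ((ellE (k ^ 2) (hka.pow 2) (sq_mem_Ioo k hk)).constMul 2 (isAlgebraic_nat 2)) ∈
      relations := by
  rw [← mkQ_eq_mkQ_iff, map_add, mkQ_constMul, mkQ_constMul, mkQ_constMul]
  exact mkQ_landen_second k hka hk

/-- **Landen's transformation of the second kind** `(1+k) E(2√k/(1+k)) + (1-k²) K(k) = 2 E(k)`:
`(1+k) ∫₀¹ √((1-λt²)/(1-t²)) dt + (1-k²) ∫₀¹ dt/√((1-t²)(1-k²t²)) = 2 ∫₀¹ √((1-k²t²)/(1-t²)) dt`,
`λ = 4k/(1+k)²`, for every real algebraic `k ∈ (0,1)`. -/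
theorem landen_second (hka : IsAlgebraic ℚ k) (hk : k ∈ Ioo (0:ℝ) 1) :
    (1 + k) * (∫ t in Ioo (0:ℝ) 1, ellEf (landenMod k) t) +
      (1 - k ^ 2) * (∫ t in Ioo (0:ℝ) 1, ellKf (k ^ 2) t) =
      2 * ∫ t in Ioo (0:ℝ) 1, ellEf (k ^ 2) t := by
  have h := congrArg evalQ (mkQ_landen_second k hka hk)
  rw [map_add, evalQ_smul, evalQ_smul, evalQ_smul, evalQ_mkQ, evalQ_mkQ, evalQ_mkQ, eval_of,
    eval_of, eval_of, ellE_value, ellK_value, ellE_value] at h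
  simpa using h

end

end SecondKind

end SoloBlind

end Summit.KontsevichZagierPeriods.KontsevichZagierPeriods.Theorems
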